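import Literature.MathematicalPhysics.QuantumFieldTheory.Balaban1983to89.B1Eq324BenfattoMarkov
import Mathlib.Analysis.Matrix.Order
import HarnessLib

/-!
# `Balaban1983to89.B1Eq324BenfattoTwoStage` — [BenfattoEtAl1978] p. 152 / §5 p. 155, p. 159: CONDITIONING IN TWO STAGES — the Gaussian regression
# given `z_C` followed by the regression given `z_Γ` is the regression given `z_{C∪Γ}` (ALGEBRAIC HALF: the Dirichlet covariance of the Dirichlet
# covariance, and the conditional centre), PROVED for the free field by the maximum principle — no block-matrix algebra

statement-level skeleton of published theorems with citation tags; proofs where landed; nothing here is a claim about the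
Yang–Mills mass gap

WHY THIS MODULE (cell `pub-ymgap`, seat `dag-n08-d` gen 9, INTENT-35; node N08 [Balaban1985UV3]; the [BenfattoEtAl1978] source chain behind the
(α)-row `h324c`).  The upper bound (4.6) of the Basic Lemma is stated for `P̄(dz) = P̂₀(dz|(z̄_Δ)_{Δ∈C})` with a conditioning set `C` (p. 152), and
its proof (p. 159: *"We start from (5.13), then assuming |z_Δ| ≦ b(1 + d(Δ, I)), ∀Δ ∈ C …"*) conditions `P̄` FURTHER on the corridor variables
`z_{Γ₁}` — the two-stage conditioning `P̂₀(·|z̄_C)(·|z_{Γ₁}) = P̂₀(·|z̄_C, z_{Γ₁})`.  The tree's conditioning is the Gaussian REGRESSION dictionary of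
`B1Eq324BenfattoLemma` (`condMean`, `condCov`, `condField`); this file proves the algebraic half of the two-stage identity for it: the regression
objects of the kernel `C^C = condCov K C` over `Γ` are those of `K` over `C ∪ Γ`.  Route: UNIQUENESS of bounded solutions of the Dirichlet lattice
problem off `C ∪ Γ` (`B1Eq324BenfattoMarkov.eq_zero_of_hop_solution`, `condCov_freeCov_lattice_eq`) — the same engine as the Markov property — once
the Gram matrix of `C^C` on `Γ` is known to be invertible (§1: STRICT positivity of the Dirichlet covariance off `C`, again by the maximum principle).

WHAT IS PROVED (standard axioms; no `sorry`; no definition; `K = freeCov d α β`, `α, β > 0`, `C, Γ` finite with `Γ ∩ C = ∅`).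
* §1 ★ `posDef_covGram_condCov_freeCov` — the Gram matrix `(C^C(γ, γ′))_{γ,γ′∈Γ}` is positive DEFINITE (App. C 2): *"the conditioned variables
  (z_Δ)_{Δ∉Γ} are a non centered gaussian field with covariance C^Γ"* — non-degenerate); `isUnit_det_covGram_condCov_freeCov`.  Proof: PSD (n08-b's
  `isPosSemidefKernel_condCov_freeCov`); a null vector `v` makes `h = Σ_γ′ C^C(·,γ′)v_γ′` a bounded solution vanishing on `C ∪ Γ`, hence `0`; the
  lattice equation at `γ ∈ Γ` then gives `v_γ = 0`.
* §2 ★★ `condCov_union_eq` — `condCov K (C ∪ Γ) x y = condCov (condCov K C) Γ x y` for all `x, y` («the Dirichlet covariance on C∪Γ is the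
  Dirichlet covariance, on Γ, of the Dirichlet covariance on C»).
* §3 ★★ `condMean_union_eq` — `condMean K (C ∪ Γ) w x = condMean K C w x + condMean (condCov K C) Γ (w − condMean K C w) x` for all `x`
  (the centre given `z_{C∪Γ} = w` is the centre given `z_C = w|_C` corrected by the `C^C`-regression of the residual data on `Γ`).
HONEST SCOPE.  Algebraic/PDE half only: the MEASURE statement (the field `condField (C∪Γ)` is the conditional law of `condField C z̄` given the
`Γ`-coordinates — the analogue of `…CondLaw.integral_condField_eq` for the kernel `C^C` with centre `u_C`) and the upper pavement step with outer
measure `P̂₀(·|z̄_C)` are the sequel; count-neutral for N08; `BasicLemmaPrinted` NOT discharged; nothing about d = 4, the continuum, OS axioms, a mass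
gap or the Clay problem.
-/

noncomputable section

open Finset Matrix
open scoped BigOperators Matrix

namespace Literature.MathematicalPhysics.QuantumFieldTheory.Balaban1983to89.B1Eq324BenfattoTwoStage

open Literature.MathematicalPhysics.QuantumFieldTheory
open Literature.MathematicalPhysics.QuantumFieldTheory.Balaban1983to89.B3Sect3VectorSelfEnergy
open Literature.MathematicalPhysics.QuantumFieldTheory.Balaban1983to89.B3CxiPropagator
open Literature.MathematicalPhysics.QuantumFieldTheory.Balaban1983to89.B1Eq324BenfattoLemma
open Literature.MathematicalPhysics.QuantumFieldTheory.Balaban1983to89.B1Eq324BenfattoCondCentre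
open Literature.MathematicalPhysics.QuantumFieldTheory.Balaban1983to89.B1Eq324BenfattoAppendixC2
open Literature.MathematicalPhysics.QuantumFieldTheory.Balaban1983to89.B1Eq324BenfattoAppendixCLemma2
open Literature.MathematicalPhysics.QuantumFieldTheory.Balaban1983to89.B1Eq324BenfattoMarkov

variable {d : ℕ} {α β : ℝ}

/-! ## §0  Kernel plumbing: the hopping sum is linear -/

/-- kernel: `H(Σ_i a_i f_i) = Σ_i a_i H f_i` for a finite family. [folklore] -/
private theorem hop_sum_mul {ι : Type*} (s : Finset ι) (f : ι → ZSite d → ℝ) (a : ι → ℝ) (x : ZSite d) :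
    hop (fun z => ∑ i ∈ s, f i z * a i) x = ∑ i ∈ s, hop (f i) x * a i := by
  simp only [hop, Finset.sum_mul, add_mul, Finset.sum_add_distrib]
  congr 1 <;> exact Finset.sum_comm

/-- kernel: `H(f − g) = Hf − Hg`. [folklore] -/
private theorem hop_sub (f g : ZSite d → ℝ) (x : ZSite d) : hop (fun z => f z - g z) x = hop f x - hop g x := by
  simp only [hop]
  rw [← Finset.sum_sub_distrib]
  exact Finset.sum_congr rfl fun μ _ => by ring

/-! ## §1  The Dirichlet covariance is strictly positive definite off the conditioning set -/

section StrictPD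

/-- **THE CONDITIONED FIELD IS NON-DEGENERATE OFF `C`**: for `Γ ∩ C = ∅` the Gram matrix `(C^C(γ,γ′))_{γ,γ′∈Γ}` of the Dirichlet covariance
`C^C = condCov (freeCov d α β) C` is positive DEFINITE (App. C 2): the conditioned variables `(z_Δ)_{Δ∉C}` form an honest Gaussian field).  A null
vector `v` would make `h = Σ_{γ′} C^C(·, γ′)v_{γ′}` a bounded solution of the massive lattice equation off `C ∪ Γ` vanishing on `C ∪ Γ` — hence `0`
(`eq_zero_of_hop_solution`) — whose equation AT `γ ∈ Γ` reads `0 = β⁻¹v_γ`. [cite: BenfattoEtAl1978, Appendix C 2) (C.6)–(C.7) p.164] -/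
theorem posDef_covGram_condCov_freeCov (hα : 0 < α) (hβ : 0 < β) (C Γ : Finset (ZSite d)) (hdisj : Disjoint Γ C) :
    (covGram (condCov (freeCov d α β) C) Γ).PosDef := by
  classical
  have hpsd : (covGram (condCov (freeCov d α β) C) Γ).PosSemidef := isPosSemidefKernel_condCov_freeCov hα hβ C Γ
  refine Matrix.PosDef.of_dotProduct_mulVec_pos hpsd.isHermitian fun v hv => ?_
  refine lt_of_le_of_ne (hpsd.dotProduct_mulVec_nonneg v) fun h0 => hv ?_
  -- a null vector: `(covGram KC Γ) v = 0`
  have hMv : covGram (condCov (freeCov d α β) C) Γ *ᵥ v = 0 := (hpsd.dotProduct_mulVec_zero_iff v).mp h0.symm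
  -- the function `h = Σ_γ′ C^C(·, γ′) v_γ′`
  set h : ZSite d → ℝ := fun z => ∑ γ : Γ, condCov (freeCov d α β) C z γ * v γ with hh
  have hm : (2 * d : ℝ) < 2 * d + α ^ 2 := by nlinarith [pow_pos hα 2]
  -- bounded
  have hB : ∀ z, |h z| ≤ ∑ γ : Γ, β⁻¹ * (α ^ 2)⁻¹ * |v γ| := fun z => by
    refine (Finset.abs_sum_le_sum_abs _ _).trans (Finset.sum_le_sum fun γ _ => ?_)
    rw [abs_mul]
    exact mul_le_mul_of_nonneg_right (abs_condCov_freeCov_le hα hβ C z γ) (abs_nonneg _)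
  -- vanishes on Γ (null vector) and on C (Dirichlet)
  have hΓ0 : ∀ γ ∈ Γ, h γ = 0 := by
    intro γ hγ
    have := congrFun hMv ⟨γ, hγ⟩
    simpa only [Matrix.mulVec, dotProduct, covGram_apply, Pi.zero_apply, hh] using this
  have hC0 : ∀ c ∈ C, h c = 0 := fun c hc => by
    simp only [hh]
    exact Finset.sum_eq_zero fun γ _ => by rw [(condCov_freeCov_of_mem hα hβ C hc γ).1, zero_mul]
  -- the lattice equation of `h` off `C`: `(2d+α²)h(x) − Hh(x) = β⁻¹ Σ_γ [x = γ] v_γ`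
  have hlat : ∀ x ∉ C, (2 * d + α ^ 2) * h x - hop h x = ∑ γ : Γ, (if x = (γ : ZSite d) then β⁻¹ else 0) * v γ := by
    intro x hx
    simp only [hh]
    rw [hop_sum_mul, Finset.mul_sum, ← Finset.sum_sub_distrib]
    refine Finset.sum_congr rfl fun γ _ => ?_
    rw [← condCov_freeCov_lattice_eq hα β C hx γ]
    ring
  -- hence homogeneous off `C ∪ Γ`, so `h = 0`
  have hsol : ∀ x ∉ Γ ∪ C, (2 * d + α ^ 2) * h x = hop h x := by
    intro x hx
    rw [Finset.mem_union, not_or] at hx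
    have h1 := hlat x hx.2
    have hzero : ∑ γ : Γ, (if x = (γ : ZSite d) then β⁻¹ else 0) * v γ = 0 :=
      Finset.sum_eq_zero fun γ _ => by rw [if_neg (fun heq => hx.1 (by rw [heq]; exact γ.2)), zero_mul]
    linarith
  have hzero := eq_zero_of_hop_solution hm (Γ ∪ C) hB
    (fun x hx => (Finset.mem_union.mp hx).elim (hΓ0 x) (hC0 x)) hsol
  -- read the equation at `γ ∈ Γ`: `0 = β⁻¹ v_γ`
  funext γ
  have hγC : (γ : ZSite d) ∉ C := fun hc => Finset.disjoint_left.mp hdisj γ.2 hc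
  have h1 := hlat γ hγC
  have hhop0 : hop h γ = 0 := by
    simp only [hop, hzero, add_zero, Finset.sum_const_zero]
  rw [hzero, hhop0, mul_zero, sub_zero] at h1
  have hsum : ∑ γ' : Γ, (if (γ : ZSite d) = (γ' : ZSite d) then β⁻¹ else 0) * v γ' = β⁻¹ * v γ := by
    rw [Finset.sum_eq_single γ]
    · rw [if_pos rfl]
    · intro γ' _ hne
      rw [if_neg (fun heq => hne (Subtype.ext heq).symm), zero_mul]
    · intro hγ
      exact absurd (Finset.mem_univ γ) hγ
  rw [hsum] at h1
  have hβ' : β⁻¹ ≠ 0 := inv_ne_zero hβ.ne'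
  have := mul_eq_zero.mp h1.symm
  simpa [hβ'] using this

/-- **The Gram matrix of the Dirichlet covariance on a set disjoint from `C` is invertible**, so the second-stage regression dictionary is the
exact one. [cite: BenfattoEtAl1978, Appendix C 2) p.164] -/
theorem isUnit_det_covGram_condCov_freeCov (hα : 0 < α) (hβ : 0 < β) (C Γ : Finset (ZSite d)) (hdisj : Disjoint Γ C) :
    IsUnit (covGram (condCov (freeCov d α β) C) Γ).det :=
  (Matrix.isUnit_iff_isUnit_det _).1 (posDef_covGram_condCov_freeCov hα hβ C Γ hdisj).isUnit

end StrictPD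

/-! ## §2  The Dirichlet covariance in two stages: `C^{C∪Γ} = (C^C)^Γ` -/

section Covariance

/-- kernel: the regression form `condCov G Γ z y = G z y − Σ_c G z c · a_c(y)`, `a_c(y) = Σ_{c′} (G_ΓΓ)⁻¹_{cc′} G c′ y`. [folklore] -/
private theorem condCov_eq_sub_sum (G : ZSite d → ZSite d → ℝ) (Γ : Finset (ZSite d)) (z y : ZSite d) :
    condCov G Γ z y = G z y - ∑ c : Γ, G z c * (∑ c' : Γ, (covGram G Γ)⁻¹ c c' * G c' y) := by
  simp only [condCov, Finset.mul_sum]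
  congr 1
  exact Finset.sum_congr rfl fun c _ => Finset.sum_congr rfl fun c' _ => by ring

/-- **TWO-STAGE CONDITIONING OF THE COVARIANCE**: for disjoint finite `C`, `Γ` and the free field (`α, β > 0`),
`condCov K (C ∪ Γ) x y = condCov (condCov K C) Γ x y` — conditioning on `z_C` and then on `z_Γ` gives the Dirichlet covariance on `C ∪ Γ`.  Both sides,
as functions of `x`, are bounded solutions of `(2d + α²)f − Hf = β⁻¹δ_y` off `C ∪ Γ` vanishing on `C ∪ Γ` (the right side vanishes on `Γ` because the
Gram matrix of `C^C` on `Γ` is invertible, §1, and on `C` because `C^C` does); uniqueness (`…Markov.eq_zero_of_hop_solution`).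
[cite: BenfattoEtAl1978, p.152 «P̂₀(dz|(z̄_Δ)_{Δ∈C})», §5 (5.13) p.155, p.159; Appendix C 2) p.164] -/
theorem condCov_union_eq (hα : 0 < α) (hβ : 0 < β) (C Γ : Finset (ZSite d)) (hdisj : Disjoint Γ C) (x y : ZSite d) :
    condCov (freeCov d α β) (C ∪ Γ) x y = condCov (condCov (freeCov d α β) C) Γ x y := by
  classical
  have hm : (2 * d : ℝ) < 2 * d + α ^ 2 := by nlinarith [pow_pos hα 2]
  have hdetU : IsUnit (covGram (freeCov d α β) (C ∪ Γ)).det := isUnit_det_covGram_freeCov hα hβ (C ∪ Γ)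
  have hdetC : IsUnit (covGram (condCov (freeCov d α β) C) Γ).det := isUnit_det_covGram_condCov_freeCov hα hβ C Γ hdisj
  -- the coefficients of the second-stage regression of the column `C^C(·, y)`
  set a : Γ → ℝ := fun γ => ∑ γ' : Γ, (covGram (condCov (freeCov d α β) C) Γ)⁻¹ γ γ' * (condCov (freeCov d α β) C) γ' y with ha
  have hg : ∀ z, condCov (condCov (freeCov d α β) C) Γ z y = (condCov (freeCov d α β) C) z y - ∑ γ : Γ, (condCov (freeCov d α β) C) z γ * a γ := fun z => condCov_eq_sub_sum (condCov (freeCov d α β) C) Γ z y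
  -- the difference
  set w : ZSite d → ℝ := fun z => condCov (freeCov d α β) (C ∪ Γ) z y - condCov (condCov (freeCov d α β) C) Γ z y with hw
  -- bounded
  have hKCb : ∀ z t, |(condCov (freeCov d α β) C) z t| ≤ β⁻¹ * (α ^ 2)⁻¹ := fun z t => abs_condCov_freeCov_le hα hβ C z t
  obtain ⟨B, hB⟩ : ∃ B, ∀ z, |w z| ≤ B := by
    refine ⟨β⁻¹ * (α ^ 2)⁻¹ + (β⁻¹ * (α ^ 2)⁻¹ + ∑ γ : Γ, β⁻¹ * (α ^ 2)⁻¹ * |a γ|), fun z => ?_⟩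
    simp only [hw]
    refine (abs_sub _ _).trans (add_le_add (abs_condCov_freeCov_le hα hβ (C ∪ Γ) z y) ?_)
    rw [hg z]
    refine (abs_sub _ _).trans (add_le_add (hKCb z y) ((Finset.abs_sum_le_sum_abs _ _).trans (Finset.sum_le_sum fun γ _ => ?_)))
    rw [abs_mul]
    exact mul_le_mul_of_nonneg_right (hKCb z γ) (abs_nonneg _)
  -- vanishes on `C ∪ Γ`
  have hzero_on : ∀ z ∈ C ∪ Γ, w z = 0 := by
    intro z hz
    simp only [hw]
    rw [condCov_of_mem_left (C ∪ Γ) hdetU hz y]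
    rcases Finset.mem_union.mp hz with hzC | hzΓ
    · -- on `C`: `C^C(c, ·) = 0`
      rw [hg z, (condCov_freeCov_of_mem hα hβ C hzC y).1]
      rw [Finset.sum_eq_zero fun γ _ => by rw [(condCov_freeCov_of_mem hα hβ C hzC (γ : ZSite d)).1, zero_mul]]
      ring
    · rw [condCov_of_mem_left (G := (condCov (freeCov d α β) C)) Γ hdetC hzΓ y, sub_zero]
  -- homogeneous equation off `C ∪ Γ`
  have hsol : ∀ z ∉ C ∪ Γ, (2 * d + α ^ 2) * w z = hop w z := by
    intro z hz
    have hzC : z ∉ C := fun h => hz (Finset.mem_union_left _ h)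
    have hzΓ : z ∉ Γ := fun h => hz (Finset.mem_union_right _ h)
    -- first stage on `C ∪ Γ`
    have h1 := condCov_freeCov_lattice_eq hα β (C ∪ Γ) hz y
    -- second stage: the column `(condCov (freeCov d α β) C)(·, y)` and the columns `(condCov (freeCov d α β) C)(·, γ)` solve the equation off `C`
    have h2 := condCov_freeCov_lattice_eq hα β C hzC y
    have h3 : ∀ γ : Γ, (2 * d + α ^ 2) * (condCov (freeCov d α β) C) z γ - hop (fun t => (condCov (freeCov d α β) C) t γ) z = 0 := by
      intro γ
      have h := condCov_freeCov_lattice_eq hα β C hzC (γ : ZSite d)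
      rw [if_neg (fun heq => hzΓ (by rw [heq]; exact γ.2))] at h
      exact h
    have hg' : (fun t => condCov (condCov (freeCov d α β) C) Γ t y) = fun t => (condCov (freeCov d α β) C) t y - ∑ γ : Γ, (condCov (freeCov d α β) C) t γ * a γ := funext hg
    have hwexp : w = fun t => condCov (freeCov d α β) (C ∪ Γ) t y - ((condCov (freeCov d α β) C) t y - ∑ γ : Γ, (condCov (freeCov d α β) C) t γ * a γ) := by
      funext t
      simp only [hw, hg t]
    rw [hwexp, hop_sub, hop_sub, hop_sum_mul]
    simp only
    have hsum : (2 * d + α ^ 2) * ∑ γ : Γ, (condCov (freeCov d α β) C) z γ * a γ - ∑ γ : Γ, hop (fun t => (condCov (freeCov d α β) C) t γ) z * a γ = 0 := by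
      rw [Finset.mul_sum, ← Finset.sum_sub_distrib]
      refine Finset.sum_eq_zero fun γ _ => ?_
      have := h3 γ
      calc (2 * d + α ^ 2) * ((condCov (freeCov d α β) C) z γ * a γ) - hop (fun t => (condCov (freeCov d α β) C) t γ) z * a γ
          = ((2 * d + α ^ 2) * (condCov (freeCov d α β) C) z γ - hop (fun t => (condCov (freeCov d α β) C) t γ) z) * a γ := by ring
        _ = 0 := by rw [this, zero_mul]
    have e1 : (2 * d + α ^ 2) * condCov (freeCov d α β) (C ∪ Γ) z y - hop (fun t => condCov (freeCov d α β) (C ∪ Γ) t y) z = if z = y then β⁻¹ else 0 := h1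
    have e2 : (2 * d + α ^ 2) * (condCov (freeCov d α β) C) z y - hop (fun t => (condCov (freeCov d α β) C) t y) z = if z = y then β⁻¹ else 0 := h2
    linarith
  have h0 := eq_zero_of_hop_solution hm (C ∪ Γ) hB hzero_on hsol x
  simp only [hw] at h0
  linarith

/-- **Corollary: `C^{C∪Γ}` vanishes against `Γ` in the second-stage sense** — `condCov (condCov K C) Γ γ y = 0` for `γ ∈ Γ` (invertible Gram
matrix, §1). [cite: BenfattoEtAl1978, Appendix C 2) p.164] -/
theorem condCov_condCov_of_mem (hα : 0 < α) (hβ : 0 < β) (C Γ : Finset (ZSite d)) (hdisj : Disjoint Γ C) {c : ZSite d} (hc : c ∈ Γ)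
    (y : ZSite d) : condCov (condCov (freeCov d α β) C) Γ c y = 0 :=
  condCov_of_mem_left Γ (isUnit_det_covGram_condCov_freeCov hα hβ C Γ hdisj) hc y

end Covariance

/-! ## §3  The conditional centre in two stages: `u_{C∪Γ}(w) = u_C(w) + (C^C)`-regression of the residual data on `Γ` -/

section Centre

/-- kernel: a regression mean of a kernel bounded by `M` is bounded (finite sums). [folklore] -/
private theorem abs_condMean_le_of_bound {G : ZSite d → ZSite d → ℝ} {M : ℝ} (hG : ∀ x y, |G x y| ≤ M) (Γ : Finset (ZSite d))
    (zbar : ZSite d → ℝ) (x : ZSite d) :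
    |condMean G Γ zbar x| ≤ ∑ c : Γ, ∑ c' : Γ, M * |(covGram G Γ)⁻¹ c c'| * |zbar c'| := by
  unfold condMean
  refine (Finset.abs_sum_le_sum_abs _ _).trans (Finset.sum_le_sum fun c _ =>
    (Finset.abs_sum_le_sum_abs _ _).trans (Finset.sum_le_sum fun c' _ => ?_))
  rw [abs_mul, abs_mul]
  exact mul_le_mul_of_nonneg_right (mul_le_mul_of_nonneg_right (hG x c) (abs_nonneg _)) (abs_nonneg _)

/-- **TWO-STAGE CONDITIONING OF THE CENTRE**: for disjoint finite `C`, `Γ`, the free field (`α, β > 0`) and any data `w`,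
`condMean K (C ∪ Γ) w x = condMean K C w x + condMean (condCov K C) Γ (w − condMean K C w) x` — the centre given `z_{C∪Γ} = w` is the centre
given `z_C = w|_C` plus the `C^C`-regression on `Γ` of the residual `w − u_C(w)`.  Both sides are bounded, massive-harmonic off `C ∪ Γ`
(`…CondCentre.condMean_freeCov_harmonic`, the columns of `C^C` solve the equation off `C`) and equal `w` on `C ∪ Γ` (the right side: `u_C = w` and
`C^C(c, ·) = 0` on `C`; the second-stage regression reproduces its data on `Γ`, §1); uniqueness.
[cite: BenfattoEtAl1978, p.152 «P̂₀(dz|(z̄_Δ)_{Δ∈C})», §5 (5.13) p.155, p.159; Appendix C (C.7) p.164] -/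
theorem condMean_union_eq (hα : 0 < α) (hβ : 0 < β) (C Γ : Finset (ZSite d)) (hdisj : Disjoint Γ C) (w : ZSite d → ℝ) (x : ZSite d) :
    condMean (freeCov d α β) (C ∪ Γ) w x =
      condMean (freeCov d α β) C w x +
        condMean (condCov (freeCov d α β) C) Γ (fun t => w t - condMean (freeCov d α β) C w t) x := by
  classical
  have hm : (2 * d : ℝ) < 2 * d + α ^ 2 := by nlinarith [pow_pos hα 2]
  have hdetU : IsUnit (covGram (freeCov d α β) (C ∪ Γ)).det := isUnit_det_covGram_freeCov hα hβ (C ∪ Γ)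
  have hdetCC : IsUnit (covGram (freeCov d α β) C).det := isUnit_det_covGram_freeCov hα hβ C
  have hdetC : IsUnit (covGram (condCov (freeCov d α β) C) Γ).det := isUnit_det_covGram_condCov_freeCov hα hβ C Γ hdisj
  have hKb : ∀ z t, |freeCov d α β z t| ≤ β⁻¹ * (α ^ 2)⁻¹ := fun z t => abs_freeCov_le hα hβ z t
  have hKCb : ∀ z t, |condCov (freeCov d α β) C z t| ≤ β⁻¹ * (α ^ 2)⁻¹ := fun z t => abs_condCov_freeCov_le hα hβ C z t
  -- the residual data and the second-stage coefficients
  set r : ZSite d → ℝ := fun t => w t - condMean (freeCov d α β) C w t with hr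
  set a : Γ → ℝ := fun γ => ∑ γ' : Γ, (covGram (condCov (freeCov d α β) C) Γ)⁻¹ γ γ' * r γ' with ha
  have hv : ∀ z, condMean (condCov (freeCov d α β) C) Γ r z = ∑ γ : Γ, condCov (freeCov d α β) C z γ * a γ := by
    intro z
    simp only [condMean, ha, Finset.mul_sum]
    exact Finset.sum_congr rfl fun γ _ => Finset.sum_congr rfl fun γ' _ => by ring
  -- the difference
  set D : ZSite d → ℝ := fun z => condMean (freeCov d α β) (C ∪ Γ) w z -
    (condMean (freeCov d α β) C w z + condMean (condCov (freeCov d α β) C) Γ r z) with hD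
  -- bounded
  obtain ⟨B, hB⟩ : ∃ B, ∀ z, |D z| ≤ B := by
    refine ⟨(∑ c : ↥(C ∪ Γ), ∑ c' : ↥(C ∪ Γ), β⁻¹ * (α ^ 2)⁻¹ * |(covGram (freeCov d α β) (C ∪ Γ))⁻¹ c c'| * |w c'|) +
      ((∑ c : C, ∑ c' : C, β⁻¹ * (α ^ 2)⁻¹ * |(covGram (freeCov d α β) C)⁻¹ c c'| * |w c'|) +
        ∑ c : Γ, ∑ c' : Γ, β⁻¹ * (α ^ 2)⁻¹ * |(covGram (condCov (freeCov d α β) C) Γ)⁻¹ c c'| * |r c'|), fun z => ?_⟩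
    simp only [hD]
    refine (abs_sub _ _).trans (add_le_add (abs_condMean_le_of_bound hKb (C ∪ Γ) w z) ((abs_add_le _ _).trans
      (add_le_add (abs_condMean_le_of_bound hKb C w z) (abs_condMean_le_of_bound hKCb Γ r z))))
  -- equal on `C ∪ Γ`
  have hzero_on : ∀ z ∈ C ∪ Γ, D z = 0 := by
    intro z hz
    simp only [hD]
    rw [condMean_apply_of_mem _ (C ∪ Γ) w hdetU hz]
    rcases Finset.mem_union.mp hz with hzC | hzΓ
    · rw [condMean_apply_of_mem _ C w hdetCC hzC, hv z]
      rw [Finset.sum_eq_zero fun γ _ => by rw [(condCov_freeCov_of_mem hα hβ C hzC (γ : ZSite d)).1, zero_mul]]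
      ring
    · rw [condMean_apply_of_mem _ Γ r hdetC hzΓ]
      simp only [hr]
      ring
  -- harmonic off `C ∪ Γ`
  have hsol : ∀ z ∉ C ∪ Γ, (2 * d + α ^ 2) * D z = hop D z := by
    intro z hz
    have hzC : z ∉ C := fun h => hz (Finset.mem_union_left _ h)
    have hzΓ : z ∉ Γ := fun h => hz (Finset.mem_union_right _ h)
    have h1 : (2 * d + α ^ 2) * condMean (freeCov d α β) (C ∪ Γ) w z = hop (fun t => condMean (freeCov d α β) (C ∪ Γ) w t) z :=
      condMean_freeCov_harmonic β hα (C ∪ Γ) w hz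
    have h2 : (2 * d + α ^ 2) * condMean (freeCov d α β) C w z = hop (fun t => condMean (freeCov d α β) C w t) z :=
      condMean_freeCov_harmonic β hα C w hzC
    have h3 : ∀ γ : Γ, (2 * d + α ^ 2) * condCov (freeCov d α β) C z γ - hop (fun t => condCov (freeCov d α β) C t γ) z = 0 := by
      intro γ
      have h := condCov_freeCov_lattice_eq hα β C hzC (γ : ZSite d)
      rw [if_neg (fun heq => hzΓ (by rw [heq]; exact γ.2))] at h
      exact h
    have hv3 : (2 * d + α ^ 2) * condMean (condCov (freeCov d α β) C) Γ r z =
        hop (fun t => condMean (condCov (freeCov d α β) C) Γ r t) z := by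
      rw [show (fun t => condMean (condCov (freeCov d α β) C) Γ r t) = fun t => ∑ γ : Γ, condCov (freeCov d α β) C t γ * a γ from
        funext hv, hv z, hop_sum_mul, Finset.mul_sum]
      refine Finset.sum_congr rfl fun γ _ => ?_
      have := h3 γ
      calc (2 * d + α ^ 2) * (condCov (freeCov d α β) C z γ * a γ)
          = ((2 * d + α ^ 2) * condCov (freeCov d α β) C z γ - hop (fun t => condCov (freeCov d α β) C t γ) z) * a γ
            + hop (fun t => condCov (freeCov d α β) C t γ) z * a γ := by ring
        _ = hop (fun t => condCov (freeCov d α β) C t γ) z * a γ := by rw [this, zero_mul, zero_add]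
    have hDexp : D = fun t => condMean (freeCov d α β) (C ∪ Γ) w t -
        (condMean (freeCov d α β) C w t + condMean (condCov (freeCov d α β) C) Γ r t) := rfl
    have hopadd : hop (fun t => condMean (freeCov d α β) C w t + condMean (condCov (freeCov d α β) C) Γ r t) z =
        hop (fun t => condMean (freeCov d α β) C w t) z + hop (fun t => condMean (condCov (freeCov d α β) C) Γ r t) z := by
      simp only [hop, ← Finset.sum_add_distrib]
      exact Finset.sum_congr rfl fun μ _ => by ring
    rw [hDexp, hop_sub, hopadd]
    simp only
    linarith
  have h0 := eq_zero_of_hop_solution hm (C ∪ Γ) hB hzero_on hsol x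
  simp only [hD] at h0
  linarith

end Centre

end Literature.MathematicalPhysics.QuantumFieldTheory.Balaban1983to89.B1Eq324BenfattoTwoStage

end
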